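import Summits.NavierStokesRegularity.FluidComputer.PalasekTowerSuperposedRunTools

/-!
# THE SUPERPOSED RUN, I-b: free runs from the superposed datum next to the superposition (bound,
# uniqueness)

Cell `ns-blowup`, seat `ns-blowup-ecbridge-3` (g7; D-0074 GROUP C «BRIDGE SUPPORT», lineage
`host_preparation`; bears_on LADDER-NS N1, route `PalasekTowerBreakdown`, crux `EpisodeBase` = item
stmt-NavierStokesRegularity-19179, line `slot` v5). LABEL: E–C typing + kernel analysis (theorems only;
no definition, no named fact, no `sorry`). WHAT THIS IS NOT: not Navier–Stokes evidence — continuous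
dependence for GIVEN classical solutions on a fixed slab; nothing about any host, episode, `RungG 1` or
blow-up.

* `freeRun_near_superposed` — with `ṽ(t, x) = v₁(t, x) + v₂(t, x − c)` bounded by `M` on `[0, T] × ℝ³`, the
  cross Duhamel term `Φ_c` bounded by `F` with `2F · exp (36 C₀² (2M+1)² T) ≤ 1/2`, and a Schwartz superposed
  datum, every classical finite-energy solution of the UNFORCED system on `[0, s]`, `s ≤ T`, from that datum
  stays within `2F exp (36 C₀² (2M+1)² t) ≤ 1/2` of `ṽ` and is bounded by `M + 1/2` (the mild-level
  bootstrap `Literature.Analysis.FluidPDE.norm_le_of_mildRef_bootstrap`, the a-priori bound of the run from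
  Tao's class);
* `freeRun_unique_superposed` — two such runs agree on their common slab
  (`velocity_eq_of_bounded_classical`).

References: T. Tao, Anal. PDE 6 (2013) Thm. 5.4 [cite: Tao2011, Thm. 5.4 (ii)+(iv)]; J. Leray, Acta Math.
63 (1934) §19 [cite: Leray1934, §19 (3.4)–(3.8)]; S. Palasek, arXiv:2605.13827 §4
[cite: Palasek2026ElementaryModel, §4].
-/

noncomputable section

namespace Summit.NavierStokesRegularity.FluidComputer.PalasekTowerClayBridge.SuperposedRun

open Set MeasureTheory Filter Topology Function Real
open scoped ENNReal NNReal ContDiff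
open Literature.Analysis Literature.Analysis.FluidPDE

section Near

variable {T M₁ M₂ : ℝ} {v₁ v₂ : ℝ → EuclideanSpace ℝ (Fin 3) → EuclideanSpace ℝ (Fin 3)}
  {q₁ q₂ : ℝ → EuclideanSpace ℝ (Fin 3) → ℝ}

variable (hT : 0 < T)
  (h₁ : IsClassicalNSSolutionOn (Icc 0 T) 1 0 v₁ q₁)
  (hE₁ : ∃ C : ℝ≥0∞, C < ⊤ ∧ ∀ t ∈ Icc 0 T, ∫⁻ x, ‖v₁ t x‖ₑ ^ 2 ≤ C)
  (hM₁ : 0 < M₁) (hbd₁ : ∀ t ∈ Icc 0 T, ∀ y, ‖v₁ t y‖ ≤ M₁)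
  (h₂ : IsClassicalNSSolutionOn (Icc 0 T) 1 0 v₂ q₂)
  (hE₂ : ∃ C : ℝ≥0∞, C < ⊤ ∧ ∀ t ∈ Icc 0 T, ∫⁻ x, ‖v₂ t x‖ₑ ^ 2 ≤ C)
  (hM₂ : 0 < M₂) (hbd₂ : ∀ t ∈ Icc 0 T, ∀ y, ‖v₂ t y‖ ≤ M₂)
  (c : EuclideanSpace ℝ (Fin 3))

include hT h₁ hE₁ hM₁ hbd₁ h₂ hE₂ hM₂ hbd₂


/-- **Every free run from the superposed datum stays within the bootstrap bound of the superposition**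
(and is bounded by `M + 1/2`). Let `‖v₁(t,x) + v₂(t,x−c)‖ ≤ M` on the slab (`M > 0`), `‖Φ_c‖ ≤ F`
(`F ≥ 0`) with `2F · exp (36 C₀² (2M+1)² T) ≤ 1/2`, and let the superposed datum be Schwartz. Then every
classical finite-energy solution `(u', p')` of the UNFORCED system on `[0, s]`, `0 < s ≤ T`, from the
superposed datum satisfies `‖u'(t,x) − (v₁(t,x) + v₂(t,x−c))‖ ≤ 2F exp (36 C₀² (2M+1)² t) ≤ 1/2` and
`‖u'(t,x)‖ ≤ M + 1/2` on `[0, s]`. (The a-priori bound on `u'` is supplied by Tao's class; the estimate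
is the mild-level bootstrap `Literature.Analysis.FluidPDE.norm_le_of_mildRef_bootstrap`.)
[cite: Tao2011, Thm. 5.4 (ii)+(iv)] [cite: Leray1934, §19 (3.4)–(3.8)] -/
theorem freeRun_near_superposed {M F : ℝ} (hM : 0 < M)
    (hbd : ∀ t ∈ Icc 0 T, ∀ x, ‖v₁ t x + v₂ t (x - c)‖ ≤ M) (hF0 : 0 ≤ F)
    (hF : ∀ t ∈ Ioc 0 T, ∀ x,
      ‖oseenDuhamel 1 0 (fun t x => v₁ t x + v₂ t (x - c)) (fun t x => v₁ t x + v₂ t (x - c)) t x -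
        oseenDuhamel 1 0 v₁ v₁ t x -
        oseenDuhamel 1 0 (fun t x => v₂ t (x - c)) (fun t x => v₂ t (x - c)) t x‖ ≤ F)
    (hsmall : 2 * F *
      Real.exp (36 * oseenSliceConst (EuclideanSpace ℝ (Fin 3)) ^ 2 * (M + (M + 1)) ^ 2 / 1 * T) ≤ 1 / 2)
    (h0 : HasRapidSpatialDecay (fun x => v₁ 0 x + v₂ 0 (x - c)))
    {s : ℝ} (hs0 : 0 < s) (hsT : s ≤ T)
    {u' : ℝ → EuclideanSpace ℝ (Fin 3) → EuclideanSpace ℝ (Fin 3)} {p' : ℝ → EuclideanSpace ℝ (Fin 3) → ℝ}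
    (hcl' : IsClassicalNSSolutionOn (Icc 0 s) 1 0 u' p') (hu'0 : u' 0 = fun x => v₁ 0 x + v₂ 0 (x - c))
    (hE' : ∃ C : ℝ≥0∞, C < ⊤ ∧ ∀ t ∈ Icc 0 s, ∫⁻ x, ‖u' t x‖ₑ ^ 2 ≤ C) :
    ∀ t ∈ Icc 0 s, ∀ x, ‖u' t x - (v₁ t x + v₂ t (x - c))‖ ≤
        2 * F * Real.exp (36 * oseenSliceConst (EuclideanSpace ℝ (Fin 3)) ^ 2 * (M + (M + 1)) ^ 2 / 1 * t) ∧
      ‖u' t x - (v₁ t x + v₂ t (x - c))‖ ≤ 1 / 2 ∧ ‖u' t x‖ ≤ M + 1 / 2 := by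
  have hν : (0 : ℝ) < 1 := one_pos
  set lam : ℝ := 36 * oseenSliceConst (EuclideanSpace ℝ (Fin 3)) ^ 2 * (M + (M + 1)) ^ 2 / 1
    with hlam_def
  have hlam0 : 0 ≤ lam := by positivity
  have hsub : Icc 0 s ⊆ Icc 0 T := Icc_subset_Icc le_rfl hsT
  have hsubo : Ioc 0 s ⊆ Ioc 0 T := Ioc_subset_Ioc le_rfl hsT
  -- the reference field on `[0, s]`
  have h₂c := translate h₂ c
  have h0I : (0 : ℝ) ∈ Icc 0 T := ⟨le_rfl, hT.le⟩
  have hslc : ∀ t ∈ Icc 0 s, Continuous (fun x => v₁ t x + v₂ t (x - c)) := fun t ht =>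
    ((h₁.contDiff_velocity (hsub ht)).continuous).add ((h₂c.contDiff_velocity (hsub ht)).continuous)
  have hsum_eq : uncurry (fun t x => v₁ t x + v₂ t (x - c)) =
      uncurry v₁ + uncurry (fun t x => v₂ t (x - c)) := by
    funext p; rfl
  have hmeas : AEStronglyMeasurable (uncurry fun t x => v₁ t x + v₂ t (x - c))
      ((volume : Measure (ℝ × EuclideanSpace ℝ (Fin 3))).restrict (Ioo 0 s ×ˢ univ)) := by
    rw [hsum_eq]
    exact (aestronglyMeasurable_of_classical (h₁.mono hsub (uniqueDiffOn_Icc hs0))).add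
      (aestronglyMeasurable_of_classical (h₂c.mono hsub (uniqueDiffOn_Icc hs0)))
  have hrep : ∀ t ∈ Ioc 0 s, (fun x => v₁ t x + v₂ t (x - c)) =ᵐ[volume] fun x =>
      UnboundedOperators.heatExtension ((fun t x => v₁ t x + v₂ t (x - c)) 0) (1 * t) x -
        oseenDuhamel 1 0 (fun t x => v₁ t x + v₂ t (x - c)) (fun t x => v₁ t x + v₂ t (x - c)) t x +
      (oseenDuhamel 1 0 (fun t x => v₁ t x + v₂ t (x - c)) (fun t x => v₁ t x + v₂ t (x - c)) t x -
        oseenDuhamel 1 0 v₁ v₁ t x -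
        oseenDuhamel 1 0 (fun t x => v₂ t (x - c)) (fun t x => v₂ t (x - c)) t x) := fun t ht =>
    superposed_oseenMild hT h₁ hE₁ hM₁ hbd₁ h₂ hE₂ hM₂ hbd₂ c (hsubo ht)
  -- the perturbed (free) run: force `0`, bounded by some `B` (Tao class)
  have hgc : Continuous (uncurry (0 : ℝ → EuclideanSpace ℝ (Fin 3) → EuclideanSpace ℝ (Fin 3))) :=
    continuous_const
  have hG : ∀ τ ∈ Icc 0 s, ∀ y,
      ‖(0 : ℝ → EuclideanSpace ℝ (Fin 3) → EuclideanSpace ℝ (Fin 3)) τ y‖ ≤ 0 := fun τ _ y => by simp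
  have hgdiv : ∀ τ ∈ Icc 0 s,
      IsWeaklyDivFree ((0 : ℝ → EuclideanSpace ℝ (Fin 3) → EuclideanSpace ℝ (Fin 3)) τ) :=
    fun τ _ θ _ => by simp
  have hg2 : ∀ τ ∈ Icc 0 s,
      eLpNorm ((0 : ℝ → EuclideanSpace ℝ (Fin 3) → EuclideanSpace ℝ (Fin 3)) τ) 2 volume ≤
        ENNReal.ofReal 0 := fun τ _ => by simp
  have hE'nn : ∃ C : ℝ≥0, ∀ t ∈ Icc 0 s, ∫⁻ x, ‖u' t x‖ₑ ^ 2 ≤ C := by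
    obtain ⟨C, hC, hb⟩ := hE'
    exact ⟨C.toNNReal, fun t ht => (hb t ht).trans (ENNReal.coe_toNNReal hC.ne).ge⟩
  have h0' : HasRapidSpatialDecay (u' 0) := by rw [hu'0]; exact h0
  have hTao := hcl'.hasBoundedSobolevNormsOn_of_clayForce hν hs0 hE'nn h0'
    Literature.Claims.NS.ClayVariants.isSmoothOnHalfSpace_zero
    Literature.Claims.NS.ClayVariants.hasRapidSpaceTimeDecay_zero
  obtain ⟨B, -, hB⟩ := HasBoundedSobolevNormsOn.exists_forall_norm_iteratedFDeriv_le hTao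
    (fun t ht => hcl'.contDiff_velocity ht) 0
  have hbd' : ∀ t ∈ Icc 0 s, ∀ y, ‖u' t y‖ ≤ B := fun t ht y => by
    simpa using hB t ht y
  have hD : ∀ y, ‖u' 0 y - (fun t x => v₁ t x + v₂ t (x - c)) 0 y‖ ≤ 0 := fun y => by
    rw [hu'0]; simp
  -- the smallness at `s ≤ T`
  have hΨ : 2 * (0 + (F + 4 * (1 : ℝ) ^ (-(3 / 4 : ℝ)) * s ^ (1 / 4 : ℝ) * 0)) *
      Real.exp (36 * oseenSliceConst (EuclideanSpace ℝ (Fin 3)) ^ 2 * (M + (M + 1)) ^ 2 / 1 * s) ≤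
        1 / 2 := by
    have h1 : Real.exp (lam * s) ≤ Real.exp (lam * T) := Real.exp_le_exp.2 (by nlinarith)
    rw [mul_zero, add_zero, zero_add, ← hlam_def]
    calc 2 * F * Real.exp (lam * s) ≤ 2 * F * Real.exp (lam * T) := by gcongr
      _ ≤ 1 / 2 := by rw [hlam_def]; exact hsmall
  intro t ht x
  have key := sup_stability_mildRef_bootstrap hν hs0 hslc hmeas hM (fun t ht => hbd t (hsub ht)) hrep hF0
    (fun t ht => hF t (hsubo ht)) hcl' hgc hG hgdiv le_rfl hg2 hE' hbd' hD hΨ t ht x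
  have key2 := norm_le_of_mildRef_bootstrap hν hs0 hslc hmeas hM (fun t ht => hbd t (hsub ht)) hrep hF0
    (fun t ht => hF t (hsubo ht)) hcl' hgc hG hgdiv le_rfl hg2 hE' hbd' hD hΨ t ht x
  refine ⟨?_, key2.1, key2.2⟩
  have hsimp : 2 * (0 + (F + 4 * (1 : ℝ) ^ (-(3 / 4 : ℝ)) * s ^ (1 / 4 : ℝ) * 0)) = 2 * F := by ring
  rw [hsimp] at key
  exact key

/-- **Free runs from the superposed datum are unique on their common slab** (the shorter run is bounded
by `M + 1/2`, `freeRun_near_superposed`; `velocity_eq_of_bounded_classical`).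
[cite: Tao2011, Thm. 5.4 (ii)+(iv)] -/
theorem freeRun_unique_superposed {M F : ℝ} (hM : 0 < M)
    (hbd : ∀ t ∈ Icc 0 T, ∀ x, ‖v₁ t x + v₂ t (x - c)‖ ≤ M) (hF0 : 0 ≤ F)
    (hF : ∀ t ∈ Ioc 0 T, ∀ x,
      ‖oseenDuhamel 1 0 (fun t x => v₁ t x + v₂ t (x - c)) (fun t x => v₁ t x + v₂ t (x - c)) t x -
        oseenDuhamel 1 0 v₁ v₁ t x -
        oseenDuhamel 1 0 (fun t x => v₂ t (x - c)) (fun t x => v₂ t (x - c)) t x‖ ≤ F)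
    (hsmall : 2 * F *
      Real.exp (36 * oseenSliceConst (EuclideanSpace ℝ (Fin 3)) ^ 2 * (M + (M + 1)) ^ 2 / 1 * T) ≤ 1 / 2)
    (h0 : HasRapidSpatialDecay (fun x => v₁ 0 x + v₂ 0 (x - c)))
    {s s' : ℝ} (hs0 : 0 < s) (hss' : s ≤ s') (hs'T : s' ≤ T)
    {u₁ u₂ : ℝ → EuclideanSpace ℝ (Fin 3) → EuclideanSpace ℝ (Fin 3)}
    {p₁ p₂ : ℝ → EuclideanSpace ℝ (Fin 3) → ℝ}
    (hu₁ : IsClassicalNSSolutionOn (Icc 0 s) 1 0 u₁ p₁) (hu₁0 : u₁ 0 = fun x => v₁ 0 x + v₂ 0 (x - c))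
    (hEu₁ : ∃ C : ℝ≥0∞, C < ⊤ ∧ ∀ t ∈ Icc 0 s, ∫⁻ x, ‖u₁ t x‖ₑ ^ 2 ≤ C)
    (hu₂ : IsClassicalNSSolutionOn (Icc 0 s') 1 0 u₂ p₂) (hu₂0 : u₂ 0 = fun x => v₁ 0 x + v₂ 0 (x - c))
    (hEu₂ : ∃ C : ℝ≥0∞, C < ⊤ ∧ ∀ t ∈ Icc 0 s', ∫⁻ x, ‖u₂ t x‖ₑ ^ 2 ≤ C) :
    ∀ t ∈ Icc 0 s, u₂ t = u₁ t := by
  have hsub : Icc 0 s ⊆ Icc 0 s' := Icc_subset_Icc le_rfl hss'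
  have hu₂' : IsClassicalNSSolutionOn (Icc 0 s) 1 0 u₂ p₂ := hu₂.mono hsub (uniqueDiffOn_Icc hs0)
  have hEu₂' : ∃ C : ℝ≥0∞, C < ⊤ ∧ ∀ t ∈ Icc 0 s, ∫⁻ x, ‖u₂ t x‖ₑ ^ 2 ≤ C := by
    obtain ⟨C, hC, hb⟩ := hEu₂; exact ⟨C, hC, fun t ht => hb t (hsub ht)⟩
  have hB₁ : ∀ t ∈ Icc 0 s, ∀ x, ‖u₁ t x‖ ≤ M + 1 / 2 := fun t ht x =>
    (freeRun_near_superposed hT h₁ hE₁ hM₁ hbd₁ h₂ hE₂ hM₂ hbd₂ c hM hbd hF0 hF hsmall h0 hs0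
      (hss'.trans hs'T) hu₁ hu₁0 hEu₁ t ht x).2.2
  exact velocity_eq_of_bounded_classical one_pos hs0
    Literature.Claims.NS.ClayVariants.isSmoothOnHalfSpace_zero
    Literature.Claims.NS.ClayVariants.hasRapidSpaceTimeDecay_zero hu₁ hEu₁ hB₁ hu₂' hEu₂'
    (hu₂0.trans hu₁0.symm)

end Near

end Summit.NavierStokesRegularity.FluidComputer.PalasekTowerClayBridge.SuperposedRun

end
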